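import Summits.AtomisticToContinuum.FouriersLaw.Theses.ParityLiouvilleSeed
import Summits.AtomisticToContinuum.FouriersLaw.Theses.FeketeSeriesLaw
import Summits.AtomisticToContinuum.FouriersLaw.Theorems.BoundedResponseConverges.Negative.OscillationExcluded

/-!
# Crux `SuperadditiveResistance` (stmt-AtomisticToContinuum-11748) — DIAGONAL REDUCTION modulo the series law

Strategist split (crux-strategist seat `planner-cstrat-stmt-AtomisticToContinuum-11748-s1-0`, 2026-08-17) of the shared
crux `ParityLiouvilleSeed.SuperadditiveResistance = JunctionLocality.SuperadditiveResistance` (A):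
along the weak-NESS shell, `∃ C ∀ N M ≥ 2, R_N + R_M − C ≤ R_{N+M}`, `R_N := (N−1)/D_N`.

**Theorem (pure real analysis, this file).**  (A) follows from
* `EvenDoubling` (written INLINE below over the crux's own shell; it becomes the route decl `EvenDoubling` when the
  split is filed) — (A) ON THE DIAGONAL `N = M` only: `∃ C₁ ∀ N ≥ 2, 2R_N − C₁ ≤ R_{2N}` (the one split of an even chain
  that carries the exact reflection symmetry `i ↦ 2N−1−i`, `δ ↦ −δ`; the kill statistic of `Cruxes/…/Disproof.lean` §2), and
* `FeketeSeriesLaw.QuasiSubadditiveResistance` (stmt-AtomisticToContinuum-14041) — the OTHER-SIDED series law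
  `∃ C₂ ∀ N M ≥ 2, R_{N+M} ≤ R_N + R_M + C₂` (route FeketeSeriesLaw's rank-2 crux, same shell).

Proof.  `b_N := R_N + C₂` is subadditive on `{N ≥ 2}` and `R_N > 0`, so the restricted Fekete lemma in the tree
(`boundedResponseConverges_tendsto_div_of_superadditive`, applied to `−b`) gives `ℓ := lim R_N/N = inf b_N/N` and the LOWER
affine envelope `R_N ≥ ℓN − C₂`.  Put `g_N := R_N − ℓN`, so `g_N/N → 0` and `g ≥ −C₂`.  Doubling reads `2g_N − C₁ ≤ g_{2N}`,
i.e. `h_N ≤ h_{2N}/2` for `h := g − C₁`; iterating along `2^k N` and letting `k → ∞` (`h_{2^kN}/2^k → 0`) gives `h_N ≤ 0`, the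
UPPER affine envelope `R_N ≤ ℓN + C₁`.  Hence `R_N + R_M − R_{N+M} = g_N + g_M − g_{N+M} ≤ 2C₁ + C₂`.

Consequences recorded here: `superadditiveResistance_of_subs : EvenDoubling → QuasiSubadditiveResistance → (A)` (both route
copies); the converse `(A) → EvenDoubling` is trivial (`M := N`), hence `(A) ∧ QS ↔ EvenDoubling ∧ QS` — modulo the series law the crux IS
its diagonal — and, with `CruxPosition.affineResistanceLaw_iff_fourHalves` (stmt-13407 ⟺ 11748 ∧ 14041 ∧ 9127 ∧ 11749),
`AffineResistanceLaw ⟺ EvenDoubling ∧ QuasiSubadditiveResistance ∧ NonBallistic ∧ ConductanceLowerBound`.  (Doubling alone is NOT sufficient: `R_N = N·f(odd part of N)` has zero doubling defect and violates (A); some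
other-sided input is the intrinsic price, cf. `Cruxes/SuperadditiveResistance/Lines/balanced-split-concavity-transfer.lean`,
whose second stub `BalancedMaximality` is false for admissible shapes — the series law replaces it.)
References: Fekete's lemma (Hammersley's survey of sub/superadditive sequences); folklore real analysis.
-/

namespace Summit.AtomisticToContinuum.FouriersLaw.Theorems.SuperadditiveResistance.DiagonalSplit

open Filter Topology

/-- **Dyadic iteration.**  If `2 g_N − C ≤ g_{2N}` for `N ≥ 2` and `g_n/n → 0`, then `g_N ≤ C` for every `N ≥ 2`
(`h := g − C` satisfies `h_N ≤ h_{2^k N}/2^k → 0`). [folklore] -/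
theorem le_of_doubling_of_tendsto_div {g : ℕ → ℝ} {C : ℝ}
    (hd : ∀ N : ℕ, 2 ≤ N → 2 * g N - C ≤ g (N + N))
    (hlim : Tendsto (fun n : ℕ => g n / n) atTop (𝓝 0)) :
    ∀ N : ℕ, 2 ≤ N → g N ≤ C := by
  intro N hN
  -- `h n := g n - C` satisfies `h N ≤ h (2^k N) / 2^k`
  have hiter : ∀ k : ℕ, g N - C ≤ (g (2 ^ k * N) - C) / (2 : ℝ) ^ k := by
    intro k
    induction k with
    | zero => simp
    | succ k ih =>
      have h2k : 2 ≤ 2 ^ k * N := le_trans hN (Nat.le_mul_of_pos_left N (Nat.two_pow_pos k))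
      have hstep := hd (2 ^ k * N) h2k
      have e : 2 ^ k * N + 2 ^ k * N = 2 ^ (k + 1) * N := by ring
      rw [e] at hstep
      have hpow : (0 : ℝ) < (2 : ℝ) ^ k := pow_pos (by norm_num) k
      calc g N - C ≤ (g (2 ^ k * N) - C) / (2 : ℝ) ^ k := ih
        _ ≤ ((g (2 ^ (k + 1) * N) - C) / 2) / (2 : ℝ) ^ k := by
            apply div_le_div_of_nonneg_right _ hpow.le
            linarith
        _ = (g (2 ^ (k + 1) * N) - C) / (2 : ℝ) ^ (k + 1) := by
            rw [pow_succ, div_div]; ring_nf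
  -- the right-hand side tends to `0`
  have hNpos : (0 : ℝ) < N := by exact_mod_cast (show 0 < N by omega)
  have hsub : Tendsto (fun k : ℕ => 2 ^ k * N) atTop atTop := by
    refine tendsto_atTop_mono (fun k => ?_) (tendsto_pow_atTop_atTop_of_one_lt (by norm_num : 1 < 2))
    exact Nat.le_mul_of_pos_right _ (by omega)
  have h1 : Tendsto (fun k : ℕ => g (2 ^ k * N) / ((2 ^ k * N : ℕ) : ℝ)) atTop (𝓝 0) := hlim.comp hsub
  have h2 : Tendsto (fun k : ℕ => (N : ℝ) * (g (2 ^ k * N) / ((2 ^ k * N : ℕ) : ℝ))) atTop (𝓝 0) := by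
    simpa using h1.const_mul (N : ℝ)
  have h3 : Tendsto (fun k : ℕ => C / (2 : ℝ) ^ k) atTop (𝓝 0) := by
    have := tendsto_pow_atTop_nhds_zero_of_lt_one (r := (1 / 2 : ℝ)) (by norm_num) (by norm_num)
    have h := this.const_mul C
    simp only [mul_zero] at h
    refine h.congr fun k => ?_
    rw [one_div, inv_pow, div_eq_mul_inv]
  have h4 : Tendsto (fun k : ℕ => (g (2 ^ k * N) - C) / (2 : ℝ) ^ k) atTop (𝓝 0) := by
    have h := h2.sub h3
    simp only [sub_zero] at h
    refine h.congr fun k => ?_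
    have hpow : (2 : ℝ) ^ k ≠ 0 := pow_ne_zero k (by norm_num)
    have hNne : (N : ℝ) ≠ 0 := hNpos.ne'
    push_cast
    field_simp
  have : g N - C ≤ 0 := ge_of_tendsto' h4 hiter
  linarith

/-- **Lower affine envelope from the series law (subadditive Fekete on `{N ≥ 2}`).**  If `R_N > 0` and
`R_{N+M} ≤ R_N + R_M + C` for `N, M ≥ 2`, then for `ℓ := lim R_N/N` one has `ℓN − C ≤ R_N` (`N ≥ 2`) and
`(R_N − ℓN)/N → 0`.  (Apply the tree's restricted superadditive Fekete lemma to `a := −(R + C)`, whose slopes are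
bounded above by `|C|`.) [folklore] -/
theorem lower_envelope_of_quasiSubadditive {R : ℕ → ℝ} {C : ℝ}
    (hpos : ∀ N : ℕ, 2 ≤ N → 0 < R N)
    (hs : ∀ N M : ℕ, 2 ≤ N → 2 ≤ M → R (N + M) ≤ R N + R M + C) :
    ∃ ℓ : ℝ, (∀ N : ℕ, 2 ≤ N → ℓ * N - C ≤ R N) ∧
      Tendsto (fun n : ℕ => (R n - ℓ * n) / n) atTop (𝓝 0) := by
  set a : ℕ → ℝ := fun n => -(R n + C) with ha
  have hsa : ∀ n m : ℕ, 2 ≤ n → 2 ≤ m → a n + a m ≤ a (n + m) := by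
    intro n m hn hm
    have := hs n m hn hm
    simp only [ha]
    linarith
  have hslope : ∀ n : ℕ, 2 ≤ n → a n / n ≤ |C| := by
    intro n hn
    have hn0 : (0 : ℝ) < n := by exact_mod_cast (show 0 < n by omega)
    have hn1 : (1 : ℝ) ≤ n := by exact_mod_cast (show 1 ≤ n by omega)
    have han : a n ≤ |C| := by
      simp only [ha]
      linarith [hpos n hn, neg_le_abs C]
    rw [div_le_iff₀ hn0]
    nlinarith [abs_nonneg C]
  obtain ⟨s, hslim, hle⟩ := boundedResponseConverges_tendsto_div_of_superadditive hsa hslope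
  refine ⟨-s, fun N hN => ?_, ?_⟩
  · have hN0 : (0 : ℝ) < N := by exact_mod_cast (show 0 < N by omega)
    have h := hle N hN
    rw [div_le_iff₀ hN0] at h
    simp only [ha] at h
    linarith
  · have h := (hslim.neg.sub (tendsto_const_div_atTop_nhds_zero_nat C)).add_const s
    have e : (-s - 0 + s : ℝ) = 0 := by ring
    rw [e] at h
    refine h.congr' ?_
    filter_upwards [eventually_ge_atTop 1] with n hn
    have hn0 : (n : ℝ) ≠ 0 := by exact_mod_cast (show n ≠ 0 by omega)
    simp only [ha]
    field_simp
    ring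

/-- **Real-analysis core of the split.**  For `D_N > 0` (`N ≥ 2`): bounded doubling defect
(`2R_N − C₁ ≤ R_{2N}`) and the series law (`R_{N+M} ≤ R_N + R_M + C₂`, in the cast convention of
`FeketeSeriesLaw.QuasiSubadditiveResistance`) imply bounded insertion cost
`R_N + R_M − (2C₁ + C₂) ≤ R_{N+M}` for all `N, M ≥ 2`, `R_N := (N−1)/D_N`. [folklore] -/
theorem insertionBounded_of_doubling_of_quasiSubadditive {D : ℕ → ℝ}
    (hpos : ∀ N : ℕ, 2 ≤ N → 0 < D N)
    (hdbl : ∃ C₁ : ℝ, ∀ N : ℕ, 2 ≤ N →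
      2 * (((N : ℝ) - 1) / D N) - C₁ ≤ ((N : ℝ) + (N : ℝ) - 1) / D (N + N))
    (hsub : ∃ C₂ : ℝ, ∀ N M : ℕ, 2 ≤ N → 2 ≤ M →
      ((N + M - 1 : ℕ) : ℝ) / D (N + M) ≤ ((N - 1 : ℕ) : ℝ) / D N + ((M - 1 : ℕ) : ℝ) / D M + C₂) :
    ∃ C : ℝ, ∀ N M : ℕ, 2 ≤ N → 2 ≤ M →
      ((N : ℝ) - 1) / D N + ((M : ℝ) - 1) / D M - C ≤ ((N : ℝ) + (M : ℝ) - 1) / D (N + M) := by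
  obtain ⟨C₁, hC₁⟩ := hdbl
  obtain ⟨C₂, hC₂⟩ := hsub
  set R : ℕ → ℝ := fun n => ((n : ℝ) - 1) / D n with hR
  have hRpos : ∀ N : ℕ, 2 ≤ N → 0 < R N := by
    intro N hN
    have h2 : (2 : ℝ) ≤ N := by exact_mod_cast hN
    exact div_pos (by linarith) (hpos N hN)
  -- the series law in `R`-form
  have hs : ∀ N M : ℕ, 2 ≤ N → 2 ≤ M → R (N + M) ≤ R N + R M + C₂ := by
    intro N M hN hM
    have h := hC₂ N M hN hM
    have eN : ((N - 1 : ℕ) : ℝ) = (N : ℝ) - 1 := by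
      rw [Nat.cast_sub (show 1 ≤ N by omega), Nat.cast_one]
    have eM : ((M - 1 : ℕ) : ℝ) = (M : ℝ) - 1 := by
      rw [Nat.cast_sub (show 1 ≤ M by omega), Nat.cast_one]
    have eNM : ((N + M - 1 : ℕ) : ℝ) = ((N + M : ℕ) : ℝ) - 1 := by
      rw [Nat.cast_sub (show 1 ≤ N + M by omega), Nat.cast_one]
    rw [eN, eM, eNM] at h
    simpa [hR] using h
  -- lower envelope and the slope limit
  obtain ⟨ℓ, hlow, hlim⟩ := lower_envelope_of_quasiSubadditive hRpos hs
  -- the centred sequence `g := R - ℓ·` doubles and has vanishing slope, hence is bounded above by `C₁`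
  set g : ℕ → ℝ := fun n => R n - ℓ * n with hg
  have hgd : ∀ N : ℕ, 2 ≤ N → 2 * g N - C₁ ≤ g (N + N) := by
    intro N hN
    have h := hC₁ N hN
    have e : ((N : ℝ) + (N : ℝ) - 1) / D (N + N) = R (N + N) := by
      simp only [hR]; push_cast; ring_nf
    rw [e] at h
    simp only [hg]
    push_cast
    linarith
  have hglim : Tendsto (fun n : ℕ => g n / n) atTop (𝓝 0) := by simpa [hg] using hlim
  have hup : ∀ N : ℕ, 2 ≤ N → g N ≤ C₁ := le_of_doubling_of_tendsto_div hgd hglim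
  have hdown : ∀ N : ℕ, 2 ≤ N → -C₂ ≤ g N := by
    intro N hN
    have := hlow N hN
    simp only [hg]
    linarith
  refine ⟨C₁ + C₁ + C₂, fun N M hN hM => ?_⟩
  have e1 : ((N : ℝ) - 1) / D N = g N + ℓ * N := by simp only [hg, hR]; ring
  have e2 : ((M : ℝ) - 1) / D M = g M + ℓ * M := by simp only [hg, hR]; ring
  have e3 : ((N : ℝ) + (M : ℝ) - 1) / D (N + M) = g (N + M) + ℓ * ((N : ℝ) + M) := by
    simp only [hg, hR]; push_cast; ring
  rw [e1, e2, e3]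
  have h1 := hup N hN
  have h2 := hup M hM
  have h3 := hdown (N + M) (by omega)
  linarith

/-- **The split: `EvenDoubling → QuasiSubadditiveResistance → SuperadditiveResistance`** (route copy
`ParityLiouvilleSeed`; stmt-AtomisticToContinuum-11748 ⇐ diagonal doubling + stmt-AtomisticToContinuum-14041).
Instantiate both hypotheses at the crux's own parameters, uniqueness hypothesis, family, temperature and response
coefficients and apply `insertionBounded_of_doubling_of_quasiSubadditive`. [folklore] -/
theorem superadditiveResistance_of_subs :
    (∀ ω₂ lam β γ : ℝ, 0 < ω₂ → 0 < lam → 0 < β → 0 < γ → (∀ (N : ℕ) (T_L T_R : ℝ), 0 < T_L → 0 < T_R → ∀ μ ν : MeasureTheory.Measure (Literature.MathematicalPhysics.KineticTheory.HeatConduction.PhaseSpace N), (Literature.MathematicalPhysics.KineticTheory.HeatConduction.pinnedChain ω₂ lam β γ).IsSteadyState N T_L T_R μ → (Literature.MathematicalPhysics.KineticTheory.HeatConduction.pinnedChain ω₂ lam β γ).IsSteadyState N T_L T_R ν → μ = ν) → ∀ μ : (N : ℕ) → ℝ → ℝ → MeasureTheory.Measure (Literature.MathematicalPhysics.KineticTheory.HeatConduction.PhaseSpace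 N), (∀ (N : ℕ) (T_L T_R : ℝ), 0 < T_L → 0 < T_R → (Literature.MathematicalPhysics.KineticTheory.HeatConduction.pinnedChain ω₂ lam β γ).IsSteadyState N T_L T_R (μ N T_L T_R)) → ∀ T : ℝ, 0 < T → ∀ D : ℕ → ℝ, (∀ N : ℕ, Filter.Tendsto (fun δ : ℝ => (Literature.MathematicalPhysics.KineticTheory.HeatConduction.pinnedChain ω₂ lam β γ).totalCurrent (μ N (T + δ / 2) (T - δ / 2)) / δ) (nhdsWithin 0 {(0 : ℝ)}ᶜ) (nhds (D N))) → (∀ N : ℕ, 2 ≤ N → 0 < D N) → ∃ C : ℝ, ∀ N : ℕ, 2 ≤ N → 2 * (((N : ℝ) - 1) / D N) - C ≤ ((N : ℝ) + (N : ℝ) - 1) / D (N + N)) →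
      Summit.AtomisticToContinuum.FouriersLaw.Theses.FeketeSeriesLaw.QuasiSubadditiveResistance →
        Summit.AtomisticToContinuum.FouriersLaw.Theses.ParityLiouvilleSeed.SuperadditiveResistance := by
  intro hE hQ ω₂ lam β γ hω hl hβ hγ hU μ hμ T hT D hD hpos
  exact insertionBounded_of_doubling_of_quasiSubadditive hpos
    (hE ω₂ lam β γ hω hl hβ hγ hU μ hμ T hT D hD hpos) (hQ ω₂ lam β γ hω hl hβ hγ hU μ hμ T hT D hD)

/-- The same split for the twin route copy `JunctionLocality.SuperadditiveResistance` (the two decls are `rfl`-equal,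
`Cruxes/SuperadditiveResistance/Disproof.lean` `twin_eq`). [folklore] -/
theorem superadditiveResistance_of_subs' :
    (∀ ω₂ lam β γ : ℝ, 0 < ω₂ → 0 < lam → 0 < β → 0 < γ → (∀ (N : ℕ) (T_L T_R : ℝ), 0 < T_L → 0 < T_R → ∀ μ ν : MeasureTheory.Measure (Literature.MathematicalPhysics.KineticTheory.HeatConduction.PhaseSpace N), (Literature.MathematicalPhysics.KineticTheory.HeatConduction.pinnedChain ω₂ lam β γ).IsSteadyState N T_L T_R μ → (Literature.MathematicalPhysics.KineticTheory.HeatConduction.pinnedChain ω₂ lam β γ).IsSteadyState N T_L T_R ν → μ = ν) → ∀ μ : (N : ℕ) → ℝ → ℝ → MeasureTheory.Measure (Literature.MathematicalPhysics.KineticTheory.HeatConduction.PhaseSpace N), (∀ (N : ℕ) (T_L T_R : ℝ), 0 < T_L → 0 < T_R → (Literature.MathematicalPhysics.KineticTheory.HeatConduction.pinnedChain ω₂ lam β γ).IsSteadyState N T_L T_R (μ N T_L T_R)) → ∀ T : ℝ, 0 < T → ∀ D : ℕ → ℝ, (∀ N : ℕ, Filter.Tendsto (fun δ : ℝ => (Literature.MathematicalPhysics.KineticTheory.HeatConduction.pinnedChain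 ω₂ lam β γ).totalCurrent (μ N (T + δ / 2) (T - δ / 2)) / δ) (nhdsWithin 0 {(0 : ℝ)}ᶜ) (nhds (D N))) → (∀ N : ℕ, 2 ≤ N → 0 < D N) → ∃ C : ℝ, ∀ N : ℕ, 2 ≤ N → 2 * (((N : ℝ) - 1) / D N) - C ≤ ((N : ℝ) + (N : ℝ) - 1) / D (N + N)) →
      Summit.AtomisticToContinuum.FouriersLaw.Theses.FeketeSeriesLaw.QuasiSubadditiveResistance →
        Summit.AtomisticToContinuum.FouriersLaw.Theses.JunctionLocality.SuperadditiveResistance :=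
  superadditiveResistance_of_subs

end Summit.AtomisticToContinuum.FouriersLaw.Theorems.SuperadditiveResistance.DiagonalSplit
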